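import Literature.Probability.LatticeModels.SharpnessLROProofs
import Literature.Probability.LatticeModels.PlusMinusStateGibbs
import Literature.Probability.LatticeModels.PlusFreeComparison
import Literature.Probability.LatticeModels.GibbsSpecificationProofs
import Literature.Probability.LatticeModels.GibbsSpecificationDLRProofs
import HarnessLib

/-!
# Lebowitz 1977: a Gibbs measure with the plus nearest-neighbour energies has all the even correlations of `μ⁺`

Topic `Probability/LatticeModels`, namespace `Literature.Probability.LatticeModels`. Theorem-only file
(no definitions, no named facts), second step of Lebowitz' route to the structure of the
translation invariant Gibbs states of the Ising model (J. L. Lebowitz, *Coexistence of phases in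
Ising ferromagnets*, J. Stat. Phys. **16** (1977) 463–476):

* `spinCorr_le_plusCorr_of_isGibbsMeasure` — **every Gibbs measure is dominated by `μ⁺` on spin
  products**: `⟨σ_A⟩_μ ≤ ⟨σ_A⟩⁺_{β,h}` for `μ ∈ 𝒢(β,h)`, `β, h ≥ 0` (Lebowitz 1977, §3, p. 467:
  "`H(σ_Λ; +)` dominates all other b.c."; Griffiths' comparison inequality, Friedli–Velenik 2017,
  Exercise 3.31, in finite volume — the tree's `isingCorr_le_isingCorr_plus` — averaged over the
  boundary condition by the DLR equations and passed to the limit).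
* `spinCorr_plusCorr_lebowitzCoexistence` — **Lebowitz' inequality (7b) between `μ⁺` and an
  arbitrary Gibbs measure**: `⟨σ_B⟩_μ⟨σ_{A∆B}⟩⁺ - ⟨σ_B⟩⁺⟨σ_{A∆B}⟩_μ ≤ ⟨σ_A⟩⁺ - ⟨σ_A⟩_μ`
  (Lebowitz 1977, §2, eq. (7b) and §3, pp. 466–468: the finite-volume inequality for the boundary
  condition `η`, the tree's `isingCorr_lebowitzCoexistence`, is affine in the `η`-expectations, so
  it integrates against `μ(dη)` by the DLR equations, and passes to the limit `Λ ↑ ℤ^d`).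
* `spinCorr_symmDiff_eq_plusCorr` — the propagation step (Lebowitz 1977, §2, Lemma 1 and
  Corollary: if `⟨σ_A⟩_μ = ⟨σ_A⟩⁺`, `⟨σ_B⟩_μ = ⟨σ_B⟩⁺ > 0` then `⟨σ_{A∆B}⟩_μ = ⟨σ_{A∆B}⟩⁺`).
* `pow_card_spontaneousMagnetization_le_plusCorr` — `m*(β)^{|B|} ≤ ⟨σ_B⟩⁺_{β,0}` (GKS II), so all
  plus correlations are positive when `m*(β) > 0`.
* `spinCorr_eq_plusCorr_of_even` — **Lebowitz 1977, Corollary (ii) to Lemma 1 with the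
  nearest-neighbour generating sets (§2, p. 466, and §3, p. 470), for an arbitrary Gibbs
  measure**: at zero field and `m*(β) > 0`, if `μ ∈ 𝒢(β,0)` has `⟨σ_xσ_{x+eᵢ}⟩_μ = ⟨σ_xσ_{x+eᵢ}⟩⁺`
  for all nearest-neighbour pairs, then `⟨σ_A⟩_μ = ⟨σ_A⟩⁺_{β,0}` for every `A` of even cardinality
  (pairs by induction on the lattice distance, then induction on `|A|`).

Combined with `IsingGibbsMixture.lean` (even correlations of `μ⁺` ⇒ mixture of `μ⁺`, `μ⁻`) and
the energy bound for translation invariant states (`GibbsEnergyBounds.lean`), this gives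
Lebowitz' theorem on translation invariant states (`LebowitzCoexistence.lean`).

## Mathlib status

No Gibbs measures in Mathlib. Anchors: `StronglyMeasurable.integral_kernel`, `integral_mono`,
`le_of_tendsto_of_tendsto'`, `Nat.strong_induction_on`, `Finset.symmDiff`,
`symmDiff_sdiff_eq_sup`; tree: `isingCorr_lebowitzCoexistence`, `exists_unitStep_natAbs_lt`,
`plusCorr_pair_shift` (`SharpnessLROProofs.lean`), `isingCorr_le_isingCorr_plus`,
`plusCorr_mul_le` (`GKSInequalities.lean`), `plusCorr_singleton_eq_spontaneousMagnetization`
(`OnsagerYang.lean`), `tendsto_isingCorr_plus_box` (`PlusMinusStateGibbs.lean`), `plusCorr_empty`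
(`PlusFreeComparison.lean`), `IsGibbsMeasure.integral_integral_eq`
(`GibbsSpecificationDLRProofs.lean`).

## References

* J. L. Lebowitz, *Coexistence of phases in Ising ferromagnets*, J. Stat. Phys. 16 (1977)
  463–476, §2 (ineq. (5), (7b), Lemma 1 and Corollary (ii)), §3 (p. 467, p. 470).
* S. Friedli, Y. Velenik, *Statistical Mechanics of Lattice Systems*, CUP (2017), Exercise 3.31,
  Thm. 3.17, Thm. 3.20, Def. 6.13.
-/

noncomputable section

open MeasureTheory Filter Topology Finset ProbabilityTheory
open scoped symmDiff

namespace Literature.Probability.LatticeModels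

/-! ### DLR averages of finite-volume correlations -/

section DLR

variable {V : Type*} (G : SimpleGraph V) [DecidableEq V] [G.LocallyFinite] [Countable V]

/-- `η ↦ ⟨σ_C⟩^η_{Λ;β,h}` is (strongly) measurable in the boundary condition (the kernel
measurability of the Ising specification, Friedli–Velenik 2017, Lemma 6.7 / Thm. 6.8). [cite: FriedliVelenik2017, Lemma 6.7 and Thm. 6.8] -/
theorem stronglyMeasurable_isingCorr_fixed (Λ : Finset V) (β h : ℝ) (C : Finset V) :
    StronglyMeasurable fun η : SpinConfig V => isingCorr G Λ β h (.fixed η) C := by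
  have hγ : IsSpecification (isingSpecification G β h) := isSpecification_isingSpecification_holds G β h
  exact (measurable_spinProduct C).stronglyMeasurable.integral_kernel
    (κ := (⟨isingSpecification G β h Λ, hγ.measurable_fun Λ⟩ : Kernel (SpinConfig V) (SpinConfig V)))

/-- `η ↦ ⟨σ_C⟩^η_{Λ;β,h}` is integrable against any finite measure (it is measurable and bounded by
`1`). [folklore] -/
theorem integrable_isingCorr_fixed (μ : Measure (SpinConfig V)) [IsFiniteMeasure μ]
    (Λ : Finset V) (β h : ℝ) (C : Finset V) :
    Integrable (fun η : SpinConfig V => isingCorr G Λ β h (.fixed η) C) μ :=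
  Integrable.of_bound (stronglyMeasurable_isingCorr_fixed G Λ β h C).aestronglyMeasurable 1
    (Eventually.of_forall fun η => by
      rw [Real.norm_eq_abs]
      exact abs_isingCorr_le_one G Λ β h _ C)

/-- **DLR equations for spin products**: `∫ ⟨σ_C⟩^η_{Λ;β,h} μ(dη) = ⟨σ_C⟩_μ` for `μ ∈ 𝒢(β,h)`
(Friedli–Velenik 2017, Def. 6.13 with Exercise 6.6). [cite: FriedliVelenik2017, Def. 6.13 and Exercise 6.6] -/
theorem integral_isingCorr_fixed_eq_spinCorr {β h : ℝ} {μ : Measure (SpinConfig V)}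
    (hμ : IsGibbsMeasure (isingSpecification G β h) μ) (Λ : Finset V) (C : Finset V) :
    ∫ η, isingCorr G Λ β h (.fixed η) C ∂μ = spinCorr μ C := by
  haveI := hμ.isProbabilityMeasure
  have hγ : IsSpecification (isingSpecification G β h) := isSpecification_isingSpecification_holds G β h
  exact hμ.integral_integral_eq hγ Λ (integrable_spinProduct μ C)

/-- **Every Gibbs measure is dominated by the finite-volume plus state on spin products**
(Lebowitz 1977, §3, p. 467; Friedli–Velenik 2017, Exercise 3.31 averaged by the DLR equations):
for `β, h ≥ 0`, `μ ∈ 𝒢(β,h)` and `A ⊆ Λ`, `⟨σ_A⟩_μ ≤ ⟨σ_A⟩⁺_{Λ;β,h}`. [cite: Lebowitz1977, §3, p. 467] -/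
theorem spinCorr_le_isingCorr_plus_of_isGibbsMeasure {β h : ℝ} (hβ : 0 ≤ β) (hh : 0 ≤ h)
    {μ : Measure (SpinConfig V)} (hμ : IsGibbsMeasure (isingSpecification G β h) μ)
    {Λ A : Finset V} (hA : A ⊆ Λ) : spinCorr μ A ≤ isingCorr G Λ β h .plus A := by
  haveI := hμ.isProbabilityMeasure
  rw [← integral_isingCorr_fixed_eq_spinCorr G hμ Λ A]
  calc ∫ η, isingCorr G Λ β h (.fixed η) A ∂μ ≤ ∫ _, isingCorr G Λ β h .plus A ∂μ :=
        integral_mono (integrable_isingCorr_fixed G μ Λ β h A) (integrable_const _) fun η =>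
          isingCorr_le_isingCorr_plus G hβ hh (.fixed η) hA
    _ = isingCorr G Λ β h .plus A := by simp

/-- **Lebowitz' inequality (7b) between the finite-volume plus state and a Gibbs measure**
(Lebowitz 1977, §2, eq. (7b), §3, pp. 466–468, the finite-volume inequality for the boundary
condition `η` integrated against `μ(dη)`): for `β, h ≥ 0`, `μ ∈ 𝒢(β,h)` and `A, B ⊆ Λ`,
`⟨σ_B⟩_μ ⟨σ_{A∆B}⟩⁺_Λ - ⟨σ_B⟩⁺_Λ ⟨σ_{A∆B}⟩_μ ≤ ⟨σ_A⟩⁺_Λ - ⟨σ_A⟩_μ`. [cite: Lebowitz1977, §2 eq. (7b) and §3, pp. 466–468] -/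
theorem spinCorr_isingCorr_lebowitzCoexistence {β h : ℝ} (hβ : 0 ≤ β) (hh : 0 ≤ h)
    {μ : Measure (SpinConfig V)} (hμ : IsGibbsMeasure (isingSpecification G β h) μ)
    {Λ A B : Finset V} (hA : A ⊆ Λ) (hB : B ⊆ Λ) :
    spinCorr μ B * isingCorr G Λ β h .plus (A ∆ B) -
        isingCorr G Λ β h .plus B * spinCorr μ (A ∆ B) ≤
      isingCorr G Λ β h .plus A - spinCorr μ A := by
  haveI := hμ.isProbabilityMeasure
  have hfin : ∀ η : SpinConfig V,
      isingCorr G Λ β h (.fixed η) B * isingCorr G Λ β h .plus (A ∆ B) -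
          isingCorr G Λ β h .plus B * isingCorr G Λ β h (.fixed η) (A ∆ B) ≤
        isingCorr G Λ β h .plus A - isingCorr G Λ β h (.fixed η) A := fun η =>
    isingCorr_lebowitzCoexistence G hβ hh (.fixed η) hA hB
  have hiB := integrable_isingCorr_fixed G μ Λ β h B
  have hiAB := integrable_isingCorr_fixed G μ Λ β h (A ∆ B)
  have hiA := integrable_isingCorr_fixed G μ Λ β h A
  have hi1 : Integrable (fun η : SpinConfig V =>
      isingCorr G Λ β h (.fixed η) B * isingCorr G Λ β h .plus (A ∆ B) -
        isingCorr G Λ β h .plus B * isingCorr G Λ β h (.fixed η) (A ∆ B)) μ :=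
    (hiB.mul_const _).sub (hiAB.const_mul _)
  have hi2 : Integrable (fun η : SpinConfig V =>
      isingCorr G Λ β h .plus A - isingCorr G Λ β h (.fixed η) A) μ :=
    (integrable_const _).sub hiA
  calc spinCorr μ B * isingCorr G Λ β h .plus (A ∆ B) -
        isingCorr G Λ β h .plus B * spinCorr μ (A ∆ B)
      = ∫ η, (isingCorr G Λ β h (.fixed η) B * isingCorr G Λ β h .plus (A ∆ B) -
          isingCorr G Λ β h .plus B * isingCorr G Λ β h (.fixed η) (A ∆ B)) ∂μ := by
        rw [integral_sub (hiB.mul_const _) (hiAB.const_mul _), integral_mul_const,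
          integral_const_mul, integral_isingCorr_fixed_eq_spinCorr G hμ,
          integral_isingCorr_fixed_eq_spinCorr G hμ]
    _ ≤ ∫ η, (isingCorr G Λ β h .plus A - isingCorr G Λ β h (.fixed η) A) ∂μ :=
        integral_mono hi1 hi2 hfin
    _ = isingCorr G Λ β h .plus A - spinCorr μ A := by
        rw [integral_sub (integrable_const _) hiA, integral_isingCorr_fixed_eq_spinCorr G hμ,
          integral_const, smul_eq_mul, probReal_univ, one_mul]

end DLR

/-! ### On `ℤ^d`: domination by `μ⁺`, Lebowitz' inequality with `μ⁺`, and the propagation -/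

section Lattice

variable {d : ℕ}

/-- **`⟨σ_A⟩_μ ≤ ⟨σ_A⟩⁺_{β,h}` for every Gibbs measure `μ ∈ 𝒢(β,h)`, `β, h ≥ 0`** (Lebowitz 1977,
§3, p. 467, "`+` b.c. dominate all other b.c."; Friedli–Velenik 2017, Exercise 3.31 with Thm.
3.17 and (6.70)). [cite: Lebowitz1977, §3, p. 467] -/
theorem spinCorr_le_plusCorr_of_isGibbsMeasure {β h : ℝ} (hβ : 0 ≤ β) (hh : 0 ≤ h)
    {μ : Measure (SpinConfig (Site d))} (hμ : μ ∈ isingGibbsMeasures d β h)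
    (A : Finset (Site d)) : spinCorr μ A ≤ plusCorr d β h A := by
  rw [mem_isingGibbsMeasures_iff] at hμ
  obtain ⟨L₀, hL₀⟩ := exists_forall_subset_box d A
  refine ge_of_tendsto (tendsto_isingCorr_plus_box hβ h A) ?_
  filter_upwards [eventually_ge_atTop L₀] with L hL
  exact spinCorr_le_isingCorr_plus_of_isGibbsMeasure (zdGraph d) hβ hh hμ (hL₀ L hL)

/-- **Lebowitz' inequality (7b) for `μ⁺` and an arbitrary Gibbs measure on `ℤ^d`** (Lebowitz 1977,
§2, eq. (7b) with the Remark after Lemma 2, "remain valid in the limit `Λ ↗ ℤ^ν`", and §3): for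
`β, h ≥ 0`, `μ ∈ 𝒢(β,h)` and finite `A, B`,
`⟨σ_B⟩_μ ⟨σ_{A∆B}⟩⁺ - ⟨σ_B⟩⁺ ⟨σ_{A∆B}⟩_μ ≤ ⟨σ_A⟩⁺ - ⟨σ_A⟩_μ`. [cite: Lebowitz1977, §2, eq. (7b) and Remark, pp. 466–467] -/
theorem spinCorr_plusCorr_lebowitzCoexistence {β h : ℝ} (hβ : 0 ≤ β) (hh : 0 ≤ h)
    {μ : Measure (SpinConfig (Site d))} (hμ : μ ∈ isingGibbsMeasures d β h)
    (A B : Finset (Site d)) :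
    spinCorr μ B * plusCorr d β h (A ∆ B) - plusCorr d β h B * spinCorr μ (A ∆ B) ≤
      plusCorr d β h A - spinCorr μ A := by
  rw [mem_isingGibbsMeasures_iff] at hμ
  obtain ⟨L₀, hL₀⟩ := exists_forall_subset_box d (A ∪ B)
  have hp := fun C : Finset (Site d) => tendsto_isingCorr_plus_box (d := d) hβ h C
  refine le_of_tendsto_of_tendsto ((tendsto_const_nhds.mul (hp (A ∆ B))).sub
    ((hp B).mul tendsto_const_nhds)) ((hp A).sub tendsto_const_nhds) ?_
  filter_upwards [eventually_ge_atTop L₀] with L hL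
  have hAB := hL₀ L hL
  exact spinCorr_isingCorr_lebowitzCoexistence (zdGraph d) hβ hh hμ (Finset.union_subset_left hAB)
    (Finset.union_subset_right hAB)

/-- **The propagation step** (Lebowitz 1977, §2, Lemma 1 and its Corollary, p. 466): for
`β, h ≥ 0` and `μ ∈ 𝒢(β,h)`, if `⟨σ_A⟩_μ = ⟨σ_A⟩⁺`, `⟨σ_B⟩_μ = ⟨σ_B⟩⁺` and `⟨σ_B⟩⁺ > 0`, then
`⟨σ_{A∆B}⟩_μ = ⟨σ_{A∆B}⟩⁺`: (7b) gives `⟨σ_B⟩⁺(⟨σ_{A∆B}⟩_μ - ⟨σ_{A∆B}⟩⁺) ≥ 0`, and `⟨·⟩_μ ≤ ⟨·⟩⁺`. [cite: Lebowitz1977, §2, Lemma 1 and Corollary, p. 466] -/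
theorem spinCorr_symmDiff_eq_plusCorr {β h : ℝ} (hβ : 0 ≤ β) (hh : 0 ≤ h)
    {μ : Measure (SpinConfig (Site d))} (hμ : μ ∈ isingGibbsMeasures d β h)
    {A B : Finset (Site d)} (hA : spinCorr μ A = plusCorr d β h A)
    (hB : spinCorr μ B = plusCorr d β h B) (hpos : 0 < plusCorr d β h B) :
    spinCorr μ (A ∆ B) = plusCorr d β h (A ∆ B) := by
  have h1 := spinCorr_plusCorr_lebowitzCoexistence hβ hh hμ A B
  rw [hA, hB, sub_self] at h1
  have h2 := spinCorr_le_plusCorr_of_isGibbsMeasure hβ hh hμ (A ∆ B)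
  nlinarith

/-- **`m*(β)^{|B|} ≤ ⟨σ_B⟩⁺_{β,0}`** for `β ≥ 0` (GKS II in the plus state, Friedli–Velenik 2017,
Thm. 3.20, eq. (3.22), iterated over the sites of `B`, with translation invariance
`⟨σ_x⟩⁺ = m*`). [cite: FriedliVelenik2017, Thm. 3.20, eq. (3.22), p. 109] -/
theorem pow_card_spontaneousMagnetization_le_plusCorr {β : ℝ} (hβ : 0 ≤ β) (B : Finset (Site d)) :
    spontaneousMagnetization d β ^ #B ≤ plusCorr d β 0 B := by
  classical
  induction B using Finset.induction_on with
  | empty => rw [Finset.card_empty, pow_zero, plusCorr_empty hβ le_rfl]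
  | insert x B hx ih =>
    rw [Finset.card_insert_of_notMem hx, pow_succ']
    have hsd : ({x} : Finset (Site d)) ∆ B = insert x B := by
      ext y
      simp only [Finset.mem_symmDiff, Finset.mem_singleton, Finset.mem_insert]
      constructor
      · rintro (⟨rfl, -⟩ | ⟨hy, -⟩)
        · exact Or.inl rfl
        · exact Or.inr hy
      · rintro (rfl | hy)
        · exact Or.inl ⟨rfl, hx⟩
        · exact Or.inr ⟨hy, fun h => hx (h ▸ hy)⟩
    calc spontaneousMagnetization d β * spontaneousMagnetization d β ^ #B
        ≤ plusCorr d β 0 {x} * plusCorr d β 0 B := by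
          rw [plusCorr_singleton_eq_spontaneousMagnetization hβ x]
          exact mul_le_mul_of_nonneg_left ih (spontaneousMagnetization_nonneg_holds (d := d) hβ)
      _ ≤ plusCorr d β 0 ({x} ∆ B) := plusCorr_mul_le hβ le_rfl {x} B
      _ = plusCorr d β 0 (insert x B) := by rw [hsd]

/-- Hence **all plus correlations are positive when `m*(β) > 0`** (`β ≥ 0`). [cite: FriedliVelenik2017, Thm. 3.20, eq. (3.22), p. 109] -/
theorem plusCorr_pos_of_spontaneousMagnetization_pos {β : ℝ} (hβ : 0 ≤ β)
    (hm : 0 < spontaneousMagnetization d β) (B : Finset (Site d)) : 0 < plusCorr d β 0 B :=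
  (pow_pos hm _).trans_le (pow_card_spontaneousMagnetization_le_plusCorr hβ B)

/-- `{a, b} ∆ {b, c} = {a, c}` for pairwise distinct sites. [folklore] -/
theorem pair_symmDiff_pair {α : Type*} [DecidableEq α] {a b c : α} (hab : a ≠ b) (hbc : b ≠ c)
    (hac : a ≠ c) : ({a, b} : Finset α) ∆ {b, c} = {a, c} := by
  ext w
  simp only [Finset.mem_symmDiff, Finset.mem_insert, Finset.mem_singleton]
  constructor
  · rintro (⟨rfl | rfl, h2⟩ | ⟨rfl | rfl, h2⟩)
    · exact Or.inl rfl
    · exact absurd (Or.inl rfl) h2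
    · exact absurd (Or.inr rfl) h2
    · exact Or.inr rfl
  · rintro (rfl | rfl)
    · exact Or.inl ⟨Or.inl rfl, fun h => h.elim hab hac⟩
    · exact Or.inr ⟨Or.inr rfl, fun h => h.elim (fun h => hac h.symm) fun h => hbc h.symm⟩

/-- **Pairs** (Lebowitz 1977, §3, p. 470: the nearest-neighbour pairs `{0, e_α}` generate, e.g.
`(σ₀σ_{e₁})(σ_{e₁}σ_{e₁+e₂}) = σ₀σ_{e₁+e₂}`): for `β ≥ 0` with `m*(β) > 0` and `μ ∈ 𝒢(β,0)` whose
nearest-neighbour pair correlations are those of `μ⁺`, `⟨σ_xσ_{x+z}⟩_μ = ⟨σ_xσ_{x+z}⟩⁺` for all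
`x` and `z ≠ 0` (induction on `∑ⱼ |zⱼ|`, one application of the propagation step per lattice
step). [cite: Lebowitz1977, §2, Corollary (ii) to Lemma 1, p. 466, and §3, p. 470] -/
theorem spinCorr_pair_eq_plusCorr {β : ℝ} (hβ : 0 ≤ β) (hm : 0 < spontaneousMagnetization d β)
    {μ : Measure (SpinConfig (Site d))} (hμ : μ ∈ isingGibbsMeasures d β 0)
    (hnn : ∀ (x : Site d) (i : Fin d),
      spinCorr μ {x, x + Pi.single i 1} = plusCorr d β 0 {x, x + Pi.single i 1}) :
    ∀ (z : Site d), z ≠ 0 → ∀ x : Site d, spinCorr μ {x, x + z} = plusCorr d β 0 {x, x + z} := by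
  suffices h : ∀ n : ℕ, ∀ z : Site d, z ≠ 0 → ∑ j, (z j).natAbs = n →
      ∀ x : Site d, spinCorr μ {x, x + z} = plusCorr d β 0 {x, x + z} from
    fun z hz x => h _ z hz rfl x
  intro n
  induction n using Nat.strong_induction_on with
  | _ n ih =>
  intro z hz hn x
  obtain ⟨i, hi⟩ : ∃ i, z i ≠ 0 := by
    by_contra hall
    push Not at hall
    exact hz (funext hall)
  obtain ⟨z', y, hlt, hpair, hz'z⟩ := exists_unitStep_natAbs_lt hi
  -- the translated nearest-neighbour pair `{x + z', x + z} = {x + y, x + y + eᵢ}`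
  have hpair' : ({x + z', x + z} : Finset (Site d)) = {x + y, x + y + Pi.single i 1} := by
    have := congrArg (Finset.map (Site.shift x).toEmbedding) hpair
    rw [Finset.map_insert, Finset.map_singleton, Finset.map_insert, Finset.map_singleton,
      Equiv.toEmbedding_apply, Equiv.toEmbedding_apply, Equiv.toEmbedding_apply,
      Equiv.toEmbedding_apply, Site.shift_apply, Site.shift_apply, Site.shift_apply,
      Site.shift_apply] at this
    rw [add_comm x z', add_comm x z, add_comm x y, add_right_comm y x (Pi.single i 1)]
    exact this
  have hB : spinCorr μ {x + z', x + z} = plusCorr d β 0 {x + z', x + z} := by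
    rw [hpair', hnn]
  by_cases hz0 : z' = 0
  · rw [hz0, add_zero] at hB
    exact hB
  · -- `{x, x+z} = {x, x+z'} ∆ {x+z', x+z}`
    have hA : spinCorr μ {x, x + z'} = plusCorr d β 0 {x, x + z'} := ih _ (hn ▸ hlt) z' hz0 rfl x
    have h1 : x ≠ x + z' := fun h => hz0 (left_eq_add.1 h)
    have h2 : x + z' ≠ x + z := fun h => hz'z (add_left_cancel h)
    have h3 : x ≠ x + z := fun h => hz (left_eq_add.1 h)
    have hsd := pair_symmDiff_pair h1 h2 h3
    rw [← hsd]
    exact spinCorr_symmDiff_eq_plusCorr hβ le_rfl hμ hA hB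
      (plusCorr_pos_of_spontaneousMagnetization_pos hβ hm _)

/-- **Lebowitz 1977, Corollary (ii) to Lemma 1 (§2, p. 466) with the nearest-neighbour generating
sets (§3, p. 470), for an arbitrary Gibbs measure**: for the nearest-neighbour Ising model on `ℤ^d`
at `β ≥ 0` with `m*(β) > 0` and zero field, if `μ ∈ 𝒢(β,0)` has the nearest-neighbour pair
correlations of the plus state, `⟨σ_xσ_{x+eᵢ}⟩_μ = ⟨σ_xσ_{x+eᵢ}⟩⁺_{β,0}` for all `x`, `i`, then
`⟨σ_A⟩_μ = ⟨σ_A⟩⁺_{β,0}` for every finite `A` of even cardinality ("`⟨σᵢσⱼ⟩ = ⟨σᵢσⱼ⟩' ≠ 0` for all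
`i, j` implies `⟨σ_E⟩ = ⟨σ_E⟩'` for `|E|` even"; induction on `|A|` through the propagation step,
all `⟨σ_B⟩⁺ ≥ m*^{|B|} > 0`). [cite: Lebowitz1977, §2, Corollary (ii) to Lemma 1, p. 466, and §3, p. 470] -/
theorem spinCorr_eq_plusCorr_of_even {β : ℝ} (hβ : 0 ≤ β) (hm : 0 < spontaneousMagnetization d β)
    {μ : Measure (SpinConfig (Site d))} (hμ : μ ∈ isingGibbsMeasures d β 0)
    (hnn : ∀ (x : Site d) (i : Fin d),
      spinCorr μ {x, x + Pi.single i 1} = plusCorr d β 0 {x, x + Pi.single i 1}) :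
    ∀ A : Finset (Site d), Even #A → spinCorr μ A = plusCorr d β 0 A := by
  classical
  have hμ' : IsGibbsMeasure (isingSpecification (zdGraph d) β 0) μ := hμ
  haveI := hμ'.isProbabilityMeasure
  suffices h : ∀ n : ℕ, ∀ A : Finset (Site d), #A = n → Even n → spinCorr μ A = plusCorr d β 0 A from
    fun A hA => h _ A rfl hA
  intro n
  induction n using Nat.strong_induction_on with
  | _ n ih =>
  intro A hcard heven
  by_cases hn0 : n = 0
  · subst hn0
    rw [Finset.card_eq_zero] at hcard
    subst hcard
    rw [plusCorr_empty hβ le_rfl, spinCorr]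
    simp [spinProduct]
  · -- pick two points `a ≠ b` of `A`
    have hcard2 : 2 ≤ #A := by
      rw [hcard]
      obtain ⟨k, rfl⟩ := heven
      omega
    obtain ⟨a, b, ha, hb, hab⟩ := Finset.one_lt_card_iff.1 hcard2
    set B : Finset (Site d) := A \ {a, b} with hBdef
    have hsub : ({a, b} : Finset (Site d)) ⊆ A := by
      intro w hw
      simp only [Finset.mem_insert, Finset.mem_singleton] at hw
      rcases hw with rfl | rfl
      · exact ha
      · exact hb
    have hAeq : ({a, b} : Finset (Site d)) ∆ B = A := by
      rw [hBdef, symmDiff_sdiff_eq_sup, sup_eq_right.2 hsub]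
    have hBcard : #B = n - 2 := by
      rw [hBdef, Finset.card_sdiff_of_subset hsub, Finset.card_pair hab, hcard]
    have hBeven : Even (n - 2) := by
      obtain ⟨k, rfl⟩ := heven
      exact ⟨k - 1, by omega⟩
    have hBcorr : spinCorr μ B = plusCorr d β 0 B := ih (n - 2) (by omega) B hBcard hBeven
    -- the pair `{a, b}`
    have hpair : spinCorr μ {a, b} = plusCorr d β 0 {a, b} := by
      have hz : b - a ≠ 0 := sub_ne_zero.2 hab.symm
      have := spinCorr_pair_eq_plusCorr hβ hm hμ hnn (b - a) hz a
      rwa [add_sub_cancel] at this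
    rw [← hAeq]
    exact spinCorr_symmDiff_eq_plusCorr hβ le_rfl hμ hpair hBcorr
      (plusCorr_pos_of_spontaneousMagnetization_pos hβ hm B)

end Lattice

end Literature.Probability.LatticeModels
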